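import Summits.BirchSwinnertonDyer.BirchSwinnertonDyer.Theorems.ManinLocalTwoThreeShimuraThreeKernelLine
import Literature.NumberTheory.EllipticCurves.PeriodLatticeGamma1QuotientProofs
import Literature.NumberTheory.EllipticCurves.AtkinLehnerSymbolSymmetryProofs
import Literature.NumberTheory.EllipticCurves.AtkinLehnerInvolutionsNewformProofs
import HarnessLib

/-!
# ATKIN–LEHNER PARITY OF THE SHIMURA QUOTIENT: `w_Q f = εf` ⟹ `θ(d*) = ε·θ(d)` on `Λ₀(f)/Λ₁(f)` (`d* ≡ d mod Q`, `≡ d⁻¹ mod N/Q`); at `9 ∣ N` a Shimura `3`-kernel needs EXACTLY ONE Atkin–Lehner minus prime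
(route `ManinLocalTwoThree`, crux C3 `ManinPrimeToThreeAtNine` stmt-BirchSwinnertonDyer-22968; cell bsd-f2-manin, C3 LEAD p1 gen 17;
`--supports stmt-BirchSwinnertonDyer-22968`; node E-an-221 — fourth habitat file, sequel to `…ShimuraQuotientFrickeParity` (p741278))

THE MECHANISM.  Every Atkin–Lehner involution `w_Q` (`Q ∥ N`) normalises `Γ₀(N)` and `Γ₁(N)` and acts on the diamond operators by
`⟨d⟩ ↦ ⟨d*⟩`, `d* ≡ d⁻¹ (mod Q)`, `d* ≡ d (mod N/Q)`; so on the Shimura character `θ : (ℤ/N)ˣ → Λ₀(f)/Λ₁(f)`, `θ(d) = {∞, γ_d ∞}_f mod Λ₁(f)`,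
one has `θ(d*) = ε_Q θ(d)`.  Lattice proof (no group schemes): Manin's relation at the cusp `r = 1/M` (`M = N/Q`) and the tree's Atkin–Lehner flip
`modularSymbol_div_eq_neg_mul_atkinLehner` (`{∞, u/m} = −ε{∞, v/m}` for `a m − u Q v = 1`, `M ∣ m`) applied to `1/M` and to `γ(1/M) = (a + bM)/(c + dM)`:
the two flipped cusps differ by an EXPLICIT `δ ∈ Γ₀(N)` (the quotient of the two flip matrices) with `{∞, γ∞}_f = −ε·{∞, δ∞}_f` and
`d_δ ≡ ±d_γ (mod Q)`, `d_δ ≡ ±a_γ ≡ ±d_γ⁻¹ (mod M)` (`exists_atkinLehner_companion`).  Consequences (all UNCONDITIONAL):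
* §2 **`w_Q f = f` ⟹ `2·{∞, γ∞}_f ∈ Λ₁(f)` whenever `d_γ ≡ 1 (mod N/Q)`** (`θ` restricted to the `(ℤ/Q)ˣ`-factor is `2`-torsion);
  **`w_Q f = −f` ⟹ `2·{∞, γ∞}_f ∈ Λ₁(f)` whenever `d_γ ≡ 1 (mod Q)`** (`θ` restricted to the `(ℤ/(N/Q))ˣ`-factor is `2`-torsion);
  at `9 ∣ N` (`3Λ₀ ⊆ Λ₁`) the factor `2` drops: those periods LIE IN `Λ₁(f)`.
* §3 for the newform of an `X₀(N)`-datum (Atkin–Lehner eigenvalues `±1`, tree theorem `IsNewform0.exists_atkinLehnerInvolution_eq_smul`), at `9 ∣ N`: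
  a Kummer–Shimura third-period (E-an-221's hypothesis: `Λ₁(f) = ℤ·(3u/c) + 3Λ₀(f)`, index 3) forces, for every exact divisor `Q ∥ N`, `Q > 1`:
  `w_Q f = +f ⟹ Λ₁(f) ⊇ {periods with d ≡ 1 mod N/Q}` and `w_Q f = −f ⟹ Λ₁(f) ⊇ {periods with d ≡ 1 mod Q}` — recorded as the two
  `cuspSymbol_mem_periodLatticeGamma1_of_atkinLehner_{plus,minus}_of_nine_dvd`; the census-level corollaries («exactly one AL-minus prime p₀; p₀ = 3 needs 27 ∣ N;
  p₀ ≠ 3 needs p₀ ≡ 1 (mod 3)»; 27a1: ε₃ = −1 ✓; 54a1: a₂ = −1 so ε₂ = +1, ε₃ = −1 ✓) are the lead's next file.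

HONEST FRAMING.  Unconditional theorems about the tree's period lattices; E-an-221, RES₃♭, C3, Manin's conjecture and BSD are NOT proved.  No definitions,
no named facts, no sorry.
[cite: AtkinLehner1970, §2, Lemmas 8–10 and Thm. 3 (w_Q normalises Γ₀(N); newforms are w_Q-eigen)] [cite: Knapp1993, Lemma 9.24, Thm. 9.27]
[cite: Manin1972, Prop. 1.4 / Thm. 1.6 (Manin relation)] [cite: MazurTateTeitelbaum1986Invent, §I.17 (the Atkin–Lehner flip of modular symbols)]
-/

set_option autoImplicit false
-- lint-debt: the directory name repeats the summit name (sibling precedent `ManinLocalTwoThreeShimuraQuotientFrickeParity.lean`)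
set_option linter.dupNamespace false

noncomputable section

open scoped Classical ComplexConjugate MatrixGroups ModularForm PeriodPair
open CongruenceSubgroup Complex
open WeierstrassCurve Literature.NumberTheory.EllipticCurves Literature.NumberTheory.EllipticCurves.ModularForms
open Summit.BirchSwinnertonDyer.Rank1Residual.ManinAdditive.CuspidalKummer
open Summit.BirchSwinnertonDyer.Rank1Residual.ManinAdditive.CuspidalKummerThree
open Summit.BirchSwinnertonDyer.Rank1Residual.ManinAdditive.UDCKummerLine
open Summit.BirchSwinnertonDyer.Rank1Residual.ManinAdditive.UDCKummerLineK
open Summit.BirchSwinnertonDyer.Rank1Residual.ManinAdditive.ShimuraThreeTorsion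

namespace Summit.BirchSwinnertonDyer.BirchSwinnertonDyer.Theorems.ManinLocalTwoThree.SigmaHabitat

/-! ## §1 The Atkin–Lehner companion -/

section Companion

variable {N : ℕ} [NeZero N] (f : CuspForm (Gamma0 N) 2) (Q : ℕ) [NeZero Q]

/-- Manin's relation at a general cusp, with the image cusp written as a quotient of integers:
`{∞, (a u + b m)/(c u + d m)}_f = {∞, γ∞}_f + {∞, u/m}_f` (`m ≠ 0`, `c u + d m ≠ 0`). [cite: Manin1972, Prop. 1.4 / Thm. 1.6] -/
theorem modularSymbol_image_eq_cuspSymbol_add (γ : Gamma0 N) {u : ℤ} {m : ℕ} (hm : m ≠ 0)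
    (hden : ((γ : SL(2, ℤ)) 1 0 : ℤ) * u + ((γ : SL(2, ℤ)) 1 1 : ℤ) * m ≠ 0) :
    modularSymbol f (((((γ : SL(2, ℤ)) 0 0 : ℤ) * u + ((γ : SL(2, ℤ)) 0 1 : ℤ) * m : ℤ) : ℚ) /
        ((((γ : SL(2, ℤ)) 1 0 : ℤ) * u + ((γ : SL(2, ℤ)) 1 1 : ℤ) * m : ℤ) : ℚ)) =
      cuspSymbol f γ + modularSymbol f ((u : ℚ) / m) := by
  have hm' : (m : ℚ) ≠ 0 := by exact_mod_cast hm
  have hden2 : ((((γ : SL(2, ℤ)) 1 0 : ℤ) * u + ((γ : SL(2, ℤ)) 1 1 : ℤ) * m : ℤ) : ℚ) ≠ 0 := by exact_mod_cast hden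
  have hden' : (((γ : SL(2, ℤ)) 1 0 : ℤ) : ℚ) * ((u : ℚ) / m) + (((γ : SL(2, ℤ)) 1 1 : ℤ) : ℚ) ≠ 0 := by
    intro h0
    apply hden2
    have e : ((((γ : SL(2, ℤ)) 1 0 : ℤ) * u + ((γ : SL(2, ℤ)) 1 1 : ℤ) * m : ℤ) : ℚ) =
        ((((γ : SL(2, ℤ)) 1 0 : ℤ) : ℚ) * ((u : ℚ) / m) + (((γ : SL(2, ℤ)) 1 1 : ℤ) : ℚ)) * m := by
      push_cast; field_simp
    rw [e, h0, zero_mul]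
  have h := modularSymbol_gamma0_smul_holds f γ ((u : ℚ) / m) hden'
  have harg : ((((γ : SL(2, ℤ)) 0 0 : ℤ) : ℚ) * ((u : ℚ) / m) + (((γ : SL(2, ℤ)) 0 1 : ℤ) : ℚ)) /
      ((((γ : SL(2, ℤ)) 1 0 : ℤ) : ℚ) * ((u : ℚ) / m) + (((γ : SL(2, ℤ)) 1 1 : ℤ) : ℚ)) =
      ((((γ : SL(2, ℤ)) 0 0 : ℤ) * u + ((γ : SL(2, ℤ)) 0 1 : ℤ) * m : ℤ) : ℚ) /
        ((((γ : SL(2, ℤ)) 1 0 : ℤ) * u + ((γ : SL(2, ℤ)) 1 1 : ℤ) * m : ℤ) : ℚ) := by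
    rw [div_eq_div_iff hden' hden2]
    push_cast
    field_simp
  rw [harg] at h
  exact h

/-- **THE ATKIN–LEHNER COMPANION (UNCONDITIONAL).**  `Q ∥ N`, `1 < Q`, `M = N/Q`, `w_Q f = ε f` (`ε² = 1`), `γ = (a b; c d) ∈ Γ₀(N)`.  Then there are
`δ ∈ Γ₀(N)` and a sign `s = ±1` with **`{∞, γ∞}_f = −ε·{∞, δ∞}_f`**, `d_δ ≡ s·d (mod Q)` and `d_δ ≡ s·a (mod M)` (so `d_δ ≡ ±d*`, `d* ≡ d (Q)`,
`≡ d⁻¹ (M)`).  Construction: flip the cusps `1/M` and `γ(1/M) = (a+bM)/(c+dM)` by `w_Q` (`modularSymbol_div_eq_neg_mul_atkinLehner`); `δ` is the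
quotient of the two flip matrices. [cite: AtkinLehner1970, §2] [cite: Manin1972, Prop. 1.4 / Thm. 1.6] [cite: MazurTateTeitelbaum1986Invent, §I.17] -/
theorem exists_atkinLehner_companion (hQN : Q ∣ N) (hc : Nat.Coprime Q (N / Q)) (hQ : 1 < Q)
    {ε : ℂ} (hε : atkinLehnerInvolution N 2 Q f = ε • f) (hε1 : ε ^ 2 = 1) (γ : Gamma0 N) :
    ∃ (δ : Gamma0 N) (s : ℤ), (s = 1 ∨ s = -1) ∧
      (Q : ℤ) ∣ ((δ : SL(2, ℤ)) 1 1 : ℤ) - s * ((γ : SL(2, ℤ)) 1 1 : ℤ) ∧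
      ((N / Q : ℕ) : ℤ) ∣ ((δ : SL(2, ℤ)) 1 1 : ℤ) - s * ((γ : SL(2, ℤ)) 0 0 : ℤ) ∧
      cuspSymbol f γ = -ε * cuspSymbol f δ := by
  -- notation
  set M : ℕ := N / Q with hMdef
  have hNQMnat : N = Q * M := by rw [hMdef, Nat.mul_div_cancel' hQN]
  have hNQM : (N : ℤ) = (Q : ℤ) * M := by exact_mod_cast hNQMnat
  have hN0 : (N : ℤ) ≠ 0 := by exact_mod_cast NeZero.ne N
  have hM0nat : M ≠ 0 := by
    intro h; apply NeZero.ne N; rw [hNQMnat, h, mul_zero]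
  have hM0 : (M : ℤ) ≠ 0 := by exact_mod_cast hM0nat
  have hMpos : 0 < M := Nat.pos_of_ne_zero hM0nat
  set a : ℤ := (γ : SL(2, ℤ)) 0 0 with ha
  set b : ℤ := (γ : SL(2, ℤ)) 0 1 with hb
  set c : ℤ := (γ : SL(2, ℤ)) 1 0 with hcc
  set d : ℤ := (γ : SL(2, ℤ)) 1 1 with hdd
  have hdet : a * d - b * c = 1 := by
    have h := Matrix.det_fin_two (γ : SL(2, ℤ)).1
    rw [Matrix.SpecialLinearGroup.det_coe] at h
    linear_combination -h
  have hc0 : ((c : ℤ) : ZMod N) = 0 := Gamma0_mem.mp γ.2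
  obtain ⟨c₁, hc₁⟩ : (N : ℤ) ∣ c := (ZMod.intCast_zmod_eq_zero_iff_dvd _ N).mp hc0
  -- Bezout for `(M, Q)`: `a₁ M − Q v = 1`
  have hcopMQ : IsCoprime (M : ℤ) (Q : ℤ) := Nat.isCoprime_iff_coprime.mpr hc.symm
  obtain ⟨a₁, w, haw⟩ := hcopMQ
  set v : ℤ := -w with hv
  have h1 : a₁ * (M : ℤ) - 1 * ((Q : ℤ) * v) = 1 := by rw [hv]; linear_combination haw
  have hMa : (M : ℤ) * a₁ = 1 + Q * v := by linear_combination h1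
  -- the image cusp `γ(1/M) = u'/m''`
  set u' : ℤ := a + b * M with hu'
  set m'' : ℤ := c + d * M with hm''
  have hm''M : m'' = (M : ℤ) * ((Q : ℤ) * c₁ + d) := by rw [hm'', hc₁, hNQM]; ring
  have hcop_du : d * u' + (-b) * m'' = 1 := by rw [hu', hm'']; linear_combination hdet
  -- `m'' ≠ 0` (else `Q ∣ 1`)
  have hm''0 : m'' ≠ 0 := by
    intro h0
    have hdu : d * u' = 1 := by have h := hcop_du; rw [h0, mul_zero, add_zero] at h; exact h
    have hQd : (Q : ℤ) ∣ d := by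
      have h2 : (Q : ℤ) * c₁ + d = 0 := by
        rcases mul_eq_zero.mp (hm''M.symm.trans h0) with h | h
        · exact absurd h hM0
        · exact h
      exact ⟨-c₁, by linear_combination h2⟩
    have hQ1 : (Q : ℤ) ∣ 1 := by rw [← hdu]; exact hQd.mul_right _
    have h3 := Int.eq_one_of_dvd_one (by positivity) hQ1
    have hQ1' : Q = 1 := by exact_mod_cast h3
    omega
  -- sign normalisation `L = s·m'' > 0`, `U = s·u'`
  set s : ℤ := Int.sign m'' with hs
  have hs1 : s = 1 ∨ s = -1 := by
    rcases lt_or_gt_of_ne hm''0 with h | h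
    · exact Or.inr (Int.sign_eq_neg_one_of_neg h)
    · exact Or.inl (Int.sign_eq_one_of_pos h)
  have hss : s * s = 1 := by rcases hs1 with h | h <;> rw [h] <;> norm_num
  have hsq : (s : ℚ) ≠ 0 := by rcases hs1 with h | h <;> rw [h] <;> norm_num
  set L : ℤ := s * m'' with hL
  set U : ℤ := s * u' with hU
  have hLpos : 0 < L := by
    rw [hL, hs, Int.sign_mul_self_eq_natAbs]
    exact_mod_cast Int.natAbs_pos.mpr hm''0
  obtain ⟨Ln, hLn⟩ : ∃ Ln : ℕ, (Ln : ℤ) = L := ⟨L.toNat, Int.toNat_of_nonneg hLpos.le⟩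
  have hLn0 : 0 < Ln := by
    have h : (0 : ℤ) < Ln := hLn ▸ hLpos
    exact_mod_cast h
  -- Bezout for `(L, U·Q)`: `a₂ L − U Q v₂ = 1`
  have hcop1 : IsCoprime m'' u' := ⟨-b, d, by linear_combination hcop_du⟩
  have hcop_dQ : IsCoprime d (Q : ℤ) := ⟨a, -(b * (M * c₁)), by rw [hc₁, hNQM] at hdet; linear_combination hdet⟩
  have hcop2 : IsCoprime m'' (Q : ℤ) := by
    have h : IsCoprime (d * M) (Q : ℤ) := hcop_dQ.mul_left (Nat.isCoprime_iff_coprime.mpr hc.symm)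
    have e : m'' = d * M + (Q : ℤ) * (M * c₁) := by rw [hm''M]; ring
    rw [e]
    exact h.add_mul_left_left (M * c₁)
  have hcop3 : IsCoprime m'' (u' * Q) := hcop1.mul_right hcop2
  obtain ⟨A, B, hAB⟩ := hcop3
  set a₂ : ℤ := s * A with ha₂
  set v₂ : ℤ := -(s * B) with hv₂
  have h2 : a₂ * (Ln : ℤ) - U * ((Q : ℤ) * v₂) = 1 := by
    rw [hLn, ha₂, hv₂, hL, hU]; linear_combination (s * s) * hAB + hss
  -- the two flips
  have hNm1 : N ∣ Q * M := by rw [← hNQMnat]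
  have hflip1 := modularSymbol_div_eq_neg_mul_atkinLehner (N := N) (Q := Q) hQN hc f hε hε1 hMpos hNm1 h1
  have hNm2 : N ∣ Q * Ln := by
    have h : (N : ℤ) ∣ (Q : ℤ) * Ln := ⟨s * ((Q : ℤ) * c₁ + d), by rw [hLn, hL, hm''M, hNQM]; ring⟩
    exact_mod_cast h
  have hflip2 := modularSymbol_div_eq_neg_mul_atkinLehner (N := N) (Q := Q) hQN hc f hε hε1 hLn0 hNm2 h2
  -- Manin for `γ` at `1/M`
  have hden1 : c * 1 + d * (M : ℤ) ≠ 0 := by rw [mul_one]; exact hm''0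
  have hManin1 := modularSymbol_image_eq_cuspSymbol_add f γ (u := 1) (m := M) hM0nat hden1
  have hLnq : ((Ln : ℕ) : ℚ) = (s : ℚ) * (m'' : ℚ) := by
    have h : ((Ln : ℤ) : ℚ) = (s : ℚ) * (m'' : ℚ) := by rw [hLn, hL]; push_cast; ring
    exact_mod_cast h
  have e_img : ((((γ : SL(2, ℤ)) 0 0 : ℤ) * 1 + ((γ : SL(2, ℤ)) 0 1 : ℤ) * (M : ℕ) : ℤ) : ℚ) /
      ((((γ : SL(2, ℤ)) 1 0 : ℤ) * 1 + ((γ : SL(2, ℤ)) 1 1 : ℤ) * (M : ℕ) : ℤ) : ℚ) = ((U : ℚ) / Ln) := by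
    have en : ((γ : SL(2, ℤ)) 0 0 : ℤ) * 1 + ((γ : SL(2, ℤ)) 0 1 : ℤ) * (M : ℕ) = u' := by rw [hu']; ring
    have ed : ((γ : SL(2, ℤ)) 1 0 : ℤ) * 1 + ((γ : SL(2, ℤ)) 1 1 : ℤ) * (M : ℕ) = m'' := by rw [hm'']; ring
    rw [en, ed, hU, hLnq]
    push_cast
    rw [mul_div_mul_left _ _ hsq]
  rw [e_img] at hManin1
  -- the companion matrix `δ = β₂ β₁⁻¹`
  let Mx : SL(2, ℤ) := ⟨!![-(Q : ℤ) * v₂ * 1 + a₂ * M, v₂ * a₁ - a₂ * v; -(Q : ℤ) * Ln * 1 + (Q : ℤ) * U * M, (Ln : ℤ) * a₁ - (Q : ℤ) * U * v], by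
    rw [Matrix.det_fin_two_of]
    linear_combination (a₂ * (Ln : ℤ) - (Q : ℤ) * U * v₂) * h1 + h2⟩
  have hMx : Mx ∈ Gamma0 N := by
    rw [Gamma0_mem]
    simp only [Mx, Matrix.of_apply, Matrix.cons_val', Matrix.cons_val_zero, Matrix.cons_val_one, Matrix.cons_val_fin_one]
    refine (ZMod.intCast_zmod_eq_zero_iff_dvd _ N).mpr ⟨s * (a + b * M - d - (Q : ℤ) * c₁), ?_⟩
    rw [hLn, hL, hU, hu', hm'', hc₁, hNQM]; ring
  have hδ11 : (((⟨Mx, hMx⟩ : Gamma0 N) : SL(2, ℤ)) 1 1 : ℤ) = (Ln : ℤ) * a₁ - (Q : ℤ) * U * v := by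
    simp only [Mx, Matrix.of_apply, Matrix.cons_val', Matrix.cons_val_one, Matrix.cons_val_fin_one]
  have hδ10 : (((⟨Mx, hMx⟩ : Gamma0 N) : SL(2, ℤ)) 1 0 : ℤ) = -(Q : ℤ) * Ln * 1 + (Q : ℤ) * U * M := by
    simp only [Mx, Matrix.of_apply, Matrix.cons_val', Matrix.cons_val_zero, Matrix.cons_val_one, Matrix.cons_val_fin_one]
  have hδ00 : (((⟨Mx, hMx⟩ : Gamma0 N) : SL(2, ℤ)) 0 0 : ℤ) = -(Q : ℤ) * v₂ * 1 + a₂ * M := by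
    simp only [Mx, Matrix.of_apply, Matrix.cons_val', Matrix.cons_val_zero, Matrix.cons_val_fin_one]
  have hδ01 : (((⟨Mx, hMx⟩ : Gamma0 N) : SL(2, ℤ)) 0 1 : ℤ) = v₂ * a₁ - a₂ * v := by
    simp only [Mx, Matrix.of_apply, Matrix.cons_val', Matrix.cons_val_zero, Matrix.cons_val_one, Matrix.cons_val_fin_one]
  -- Manin for `δ` at `v/M`: `δ(v/M) = v₂/L`
  have hden2 : (((⟨Mx, hMx⟩ : Gamma0 N) : SL(2, ℤ)) 1 0 : ℤ) * v + (((⟨Mx, hMx⟩ : Gamma0 N) : SL(2, ℤ)) 1 1 : ℤ) * (M : ℕ) ≠ 0 := by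
    rw [hδ10, hδ11]
    have e : (-(Q : ℤ) * Ln * 1 + (Q : ℤ) * U * M) * v + ((Ln : ℤ) * a₁ - (Q : ℤ) * U * v) * (M : ℕ) =
        Ln * (a₁ * M - 1 * (Q * v)) := by ring
    rw [e, h1, mul_one]
    exact_mod_cast hLn0.ne'
  have hManin2 := modularSymbol_image_eq_cuspSymbol_add f ⟨Mx, hMx⟩ (u := v) (m := M) hM0nat hden2
  have e_img2 : (((((⟨Mx, hMx⟩ : Gamma0 N) : SL(2, ℤ)) 0 0 : ℤ) * v + (((⟨Mx, hMx⟩ : Gamma0 N) : SL(2, ℤ)) 0 1 : ℤ) * (M : ℕ) : ℤ) : ℚ) /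
      ((((((⟨Mx, hMx⟩ : Gamma0 N) : SL(2, ℤ)) 1 0 : ℤ) * v + (((⟨Mx, hMx⟩ : Gamma0 N) : SL(2, ℤ)) 1 1 : ℤ) * (M : ℕ) : ℤ) : ℚ)) =
      ((v₂ : ℚ) / Ln) := by
    rw [hδ00, hδ01, hδ10, hδ11]
    have enum : (-(Q : ℤ) * v₂ * 1 + a₂ * M) * v + (v₂ * a₁ - a₂ * v) * (M : ℕ) = v₂ * (a₁ * M - 1 * (Q * v)) := by ring
    have eden : (-(Q : ℤ) * Ln * 1 + (Q : ℤ) * U * M) * v + ((Ln : ℤ) * a₁ - (Q : ℤ) * U * v) * (M : ℕ) =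
        Ln * (a₁ * M - 1 * (Q * v)) := by ring
    rw [enum, eden, h1, mul_one, mul_one]
    push_cast
    ring
  rw [e_img2] at hManin2
  -- assemble
  refine ⟨⟨Mx, hMx⟩, s, hs1, ?_, ?_, ?_⟩
  · -- `d_δ − s d = Q·(…)`
    rw [hδ11]
    refine ⟨s * ((M : ℤ) * c₁ * a₁ + d * v - a * v - b * v * M), ?_⟩
    rw [hLn, hL, hU, hu', hm'', hc₁, hNQM]
    linear_combination (s * d) * hMa
  · -- `d_δ − s a = M·(…)`
    rw [hδ11]
    refine ⟨s * ((Q : ℤ) * c₁ * a₁ + d * a₁ - a * a₁ - (Q : ℤ) * v * b), ?_⟩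
    rw [hLn, hL, hU, hu', hm'', hc₁, hNQM]
    linear_combination (s * a) * hMa
  · -- the symbol identity
    linear_combination -hManin1 + hflip2 - hflip1 - ε * hManin2

end Companion

/-! ## §2 Atkin–Lehner parity: `θ` is `2`-torsion on the `(ℤ/Q)ˣ`-factor (`w_Q = +1`) resp. on the `(ℤ/(N/Q))ˣ`-factor (`w_Q = −1`) -/

/-- Congruences modulo the coprime exact divisors `Q` and `N/Q` give a congruence modulo `N`. [folklore] -/
theorem natCast_dvd_of_dvd_of_dvd {N : ℕ} (Q : ℕ) (hQN : Q ∣ N) (hc : Nat.Coprime Q (N / Q)) {x : ℤ}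
    (hQ : (Q : ℤ) ∣ x) (hM : ((N / Q : ℕ) : ℤ) ∣ x) : (N : ℤ) ∣ x := by
  have h := (Nat.isCoprime_iff_coprime.mpr hc).mul_dvd hQ hM
  have e : ((Q : ℤ) * ((N / Q : ℕ) : ℤ)) = N := by exact_mod_cast Nat.mul_div_cancel' hQN
  rwa [e] at h

section Parity

variable {N : ℕ} [NeZero N] (f : CuspForm (Gamma0 N) 2) (Q : ℕ) [NeZero Q]

/-- `{∞, γ⁻¹∞}_f = −{∞, γ∞}_f` and `d_{γ⁻¹} = a_γ`. [cite: Manin1972, Prop. 1.4 / Thm. 1.6] -/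
theorem cuspSymbol_inv_eq_neg (γ : Gamma0 N) :
    cuspSymbol f γ⁻¹ = -cuspSymbol f γ ∧ (((γ⁻¹ : Gamma0 N) : SL(2, ℤ)) 1 1 : ℤ) = ((γ : SL(2, ℤ)) 0 0 : ℤ) := by
  constructor
  · have h := cuspSymbol_mul_holds f γ γ⁻¹
    rw [mul_inv_cancel, cuspSymbol_one] at h
    linear_combination -h
  · rw [Subgroup.coe_inv, Matrix.SpecialLinearGroup.SL2_inv_expl]
    rfl

/-- **ATKIN–LEHNER PARITY, PLUS SIGN (UNCONDITIONAL): `w_Q f = f`, `d_γ ≡ 1 (mod N/Q)` ⟹ `2·{∞, γ∞}_f ∈ Λ₁(f)`.**  The companion `δ` has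
`d_δ ≡ ±d (mod Q)` and `d_δ ≡ ±a ≡ ±d (mod N/Q)` (as `a ≡ d⁻¹ ≡ 1`), so `{∞, δ∞} ≡ {∞, γ∞} (mod Λ₁)` while `{∞, γ∞} = −{∞, δ∞}`. [cite: AtkinLehner1970, §2] -/
theorem two_mul_cuspSymbol_mem_periodLatticeGamma1_of_atkinLehner_plus (hQN : Q ∣ N) (hc : Nat.Coprime Q (N / Q)) (hQ : 1 < Q)
    (hε : atkinLehnerInvolution N 2 Q f = (1 : ℂ) • f) (γ : Gamma0 N)
    (hd : ((N / Q : ℕ) : ℤ) ∣ ((γ : SL(2, ℤ)) 1 1 : ℤ) - 1) :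
    2 * cuspSymbol f γ ∈ periodLatticeGamma1 f := by
  obtain ⟨δ, s, hs, hQd, hMd, hsym⟩ := exists_atkinLehner_companion f Q hQN hc hQ hε (by norm_num) γ
  -- `a ≡ d ≡ 1 (mod N/Q)` from `ad − bc = 1`, `N ∣ c`
  have hdet := Matrix.det_fin_two (γ : SL(2, ℤ)).1
  rw [Matrix.SpecialLinearGroup.det_coe] at hdet
  obtain ⟨c₁, hc₁⟩ : (N : ℤ) ∣ ((γ : SL(2, ℤ)) 1 0 : ℤ) := (ZMod.intCast_zmod_eq_zero_iff_dvd _ N).mp (Gamma0_mem.mp γ.2)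
  have hMN : ((N / Q : ℕ) : ℤ) ∣ (N : ℤ) := by exact_mod_cast Nat.div_dvd_of_dvd hQN
  have hMa : ((N / Q : ℕ) : ℤ) ∣ ((δ : SL(2, ℤ)) 1 1 : ℤ) - s * ((γ : SL(2, ℤ)) 1 1 : ℤ) := by
    obtain ⟨k, hk⟩ := hd
    obtain ⟨k', hk'⟩ := hMN
    have e : ((δ : SL(2, ℤ)) 1 1 : ℤ) - s * ((γ : SL(2, ℤ)) 1 1 : ℤ) =
        (((δ : SL(2, ℤ)) 1 1 : ℤ) - s * ((γ : SL(2, ℤ)) 0 0 : ℤ)) +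
          s * (-((((γ : SL(2, ℤ)) 0 0 : ℤ) + 1) * (((γ : SL(2, ℤ)) 1 1 : ℤ) - 1)) +
            ((γ : SL(2, ℤ)) 0 1 : ℤ) * ((γ : SL(2, ℤ)) 1 0 : ℤ)) := by linear_combination (-s) * hdet
    rw [e, hk, hc₁, hk']
    exact dvd_add hMd ⟨s * (-(((γ : SL(2, ℤ)) 0 0 : ℤ) + 1) * k + ((γ : SL(2, ℤ)) 0 1 : ℤ) * k' * c₁), by ring⟩
  have hNd : (N : ℤ) ∣ ((δ : SL(2, ℤ)) 1 1 : ℤ) - s * ((γ : SL(2, ℤ)) 1 1 : ℤ) := natCast_dvd_of_dvd_of_dvd Q hQN hc hQd hMa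
  -- same class modulo `Λ₁`
  have hsame : cuspSymbol f δ - cuspSymbol f γ ∈ periodLatticeGamma1 f := by
    rcases hs with h1 | h1
    · rw [h1, one_mul] at hNd
      exact cuspSymbol_sub_mem_periodLatticeGamma1_of_apply_eq f γ δ ((ZMod.intCast_eq_intCast_iff_dvd_sub _ _ N).mpr hNd)
    · obtain ⟨γ', -, -, h11, hγ'⟩ := exists_neg_entries_cuspSymbol_eq f γ
      rw [← hγ']
      refine cuspSymbol_sub_mem_periodLatticeGamma1_of_apply_eq f γ' δ ((ZMod.intCast_eq_intCast_iff_dvd_sub _ _ N).mpr ?_)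
      rw [h11]; rw [h1] at hNd; simpa using hNd
  have key : 2 * cuspSymbol f γ = -(cuspSymbol f δ - cuspSymbol f γ) := by linear_combination hsym
  rw [key]
  exact neg_mem hsame

/-- **ATKIN–LEHNER PARITY, MINUS SIGN (UNCONDITIONAL): `w_Q f = −f`, `d_γ ≡ 1 (mod Q)` ⟹ `2·{∞, γ∞}_f ∈ Λ₁(f)`.**  Here the companion has
`d_δ ≡ ±d ≡ ±1 ≡ ±a (mod Q)` and `d_δ ≡ ±a (mod N/Q)`, so `d_δ ≡ ±d_{γ⁻¹} (mod N)` and `{∞, δ∞} ≡ −{∞, γ∞} (mod Λ₁)` while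
`{∞, γ∞} = {∞, δ∞}`. [cite: AtkinLehner1970, §2] -/
theorem two_mul_cuspSymbol_mem_periodLatticeGamma1_of_atkinLehner_minus (hQN : Q ∣ N) (hc : Nat.Coprime Q (N / Q)) (hQ : 1 < Q)
    (hε : atkinLehnerInvolution N 2 Q f = (-1 : ℂ) • f) (γ : Gamma0 N)
    (hd : (Q : ℤ) ∣ ((γ : SL(2, ℤ)) 1 1 : ℤ) - 1) :
    2 * cuspSymbol f γ ∈ periodLatticeGamma1 f := by
  obtain ⟨δ, s, hs, hQd, hMd, hsym⟩ := exists_atkinLehner_companion f Q hQN hc hQ hε (by norm_num) γ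
  have hdet := Matrix.det_fin_two (γ : SL(2, ℤ)).1
  rw [Matrix.SpecialLinearGroup.det_coe] at hdet
  obtain ⟨c₁, hc₁⟩ : (N : ℤ) ∣ ((γ : SL(2, ℤ)) 1 0 : ℤ) := (ZMod.intCast_zmod_eq_zero_iff_dvd _ N).mp (Gamma0_mem.mp γ.2)
  have hQN' : (Q : ℤ) ∣ (N : ℤ) := by exact_mod_cast hQN
  -- `d_δ ≡ s·a (mod Q)` as well
  have hQa : (Q : ℤ) ∣ ((δ : SL(2, ℤ)) 1 1 : ℤ) - s * ((γ : SL(2, ℤ)) 0 0 : ℤ) := by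
    obtain ⟨k, hk⟩ := hd
    obtain ⟨k', hk'⟩ := hQN'
    have e : ((δ : SL(2, ℤ)) 1 1 : ℤ) - s * ((γ : SL(2, ℤ)) 0 0 : ℤ) =
        (((δ : SL(2, ℤ)) 1 1 : ℤ) - s * ((γ : SL(2, ℤ)) 1 1 : ℤ)) +
          s * ((((γ : SL(2, ℤ)) 0 0 : ℤ) + 1) * (((γ : SL(2, ℤ)) 1 1 : ℤ) - 1) -
            ((γ : SL(2, ℤ)) 0 1 : ℤ) * ((γ : SL(2, ℤ)) 1 0 : ℤ)) := by linear_combination s * hdet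
    rw [e, hk, hc₁, hk']
    exact dvd_add hQd ⟨s * ((((γ : SL(2, ℤ)) 0 0 : ℤ) + 1) * k - ((γ : SL(2, ℤ)) 0 1 : ℤ) * k' * c₁), by ring⟩
  obtain ⟨hinv, hinv11⟩ := cuspSymbol_inv_eq_neg f γ
  have hNd : (N : ℤ) ∣ ((δ : SL(2, ℤ)) 1 1 : ℤ) - s * (((γ⁻¹ : Gamma0 N) : SL(2, ℤ)) 1 1 : ℤ) := by
    rw [hinv11]; exact natCast_dvd_of_dvd_of_dvd Q hQN hc hQa hMd
  have hsame : cuspSymbol f δ - cuspSymbol f γ⁻¹ ∈ periodLatticeGamma1 f := by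
    rcases hs with h1 | h1
    · rw [h1, one_mul] at hNd
      exact cuspSymbol_sub_mem_periodLatticeGamma1_of_apply_eq f γ⁻¹ δ ((ZMod.intCast_eq_intCast_iff_dvd_sub _ _ N).mpr hNd)
    · obtain ⟨γ', -, -, h11, hγ'⟩ := exists_neg_entries_cuspSymbol_eq f γ⁻¹
      rw [← hγ']
      refine cuspSymbol_sub_mem_periodLatticeGamma1_of_apply_eq f γ' δ ((ZMod.intCast_eq_intCast_iff_dvd_sub _ _ N).mpr ?_)
      rw [h11]; rw [h1] at hNd; simpa using hNd
  rw [hinv] at hsame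
  have key : 2 * cuspSymbol f γ = cuspSymbol f δ - -cuspSymbol f γ := by linear_combination hsym
  rw [key]
  exact hsame

end Parity

/-! ## §3 At `9 ∣ N`: the factor `2` drops; consequences for a Kummer–Shimura third-period -/

section Nine

variable {W : WeierstrassCurve ℚ} {N : ℕ} [NeZero N]

/-- `2z ∈ Λ₁(f)` and `3z ∈ Λ₁(f)` ⟹ `z ∈ Λ₁(f)` (at `9 ∣ N` every period has `3z ∈ Λ₁`). [folklore] -/
theorem mem_periodLatticeGamma1_of_two_mul_of_nine_dvd (D : ModularParametrizationData W N) (h9 : 3 ^ 2 ∣ N)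
    {z : ℂ} (hz : z ∈ periodLattice D.f) (h2 : 2 * z ∈ periodLatticeGamma1 D.f) : z ∈ periodLatticeGamma1 D.f := by
  have h3 := three_mul_mem_periodLatticeGamma1_of_nine_dvd D h9 hz
  have he : z = 3 * z - 2 * z := by ring
  rw [he]
  exact sub_mem h3 h2

/-- **At `9 ∣ N`, `w_Q f = f`: every period `{∞, γ∞}_f` with `d_γ ≡ 1 (mod N/Q)` lies in `Λ₁(f)`** — the Shimura character factors through
`(ℤ/(N/Q))ˣ`. [cite: AtkinLehner1970, §2] -/
theorem cuspSymbol_mem_periodLatticeGamma1_of_atkinLehner_plus_of_nine_dvd (D : ModularParametrizationData W N) (h9 : 3 ^ 2 ∣ N)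
    (Q : ℕ) [NeZero Q] (hQN : Q ∣ N) (hc : Nat.Coprime Q (N / Q)) (hQ : 1 < Q)
    (hε : atkinLehnerInvolution N 2 Q D.f = (1 : ℂ) • D.f) (γ : Gamma0 N)
    (hd : ((N / Q : ℕ) : ℤ) ∣ ((γ : SL(2, ℤ)) 1 1 : ℤ) - 1) : cuspSymbol D.f γ ∈ periodLatticeGamma1 D.f :=
  mem_periodLatticeGamma1_of_two_mul_of_nine_dvd D h9 (cuspSymbol_mem_periodLattice D.f γ)
    (two_mul_cuspSymbol_mem_periodLatticeGamma1_of_atkinLehner_plus D.f Q hQN hc hQ hε γ hd)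

/-- **At `9 ∣ N`, `w_Q f = −f`: every period `{∞, γ∞}_f` with `d_γ ≡ 1 (mod Q)` lies in `Λ₁(f)`** — the Shimura character factors through
`(ℤ/Q)ˣ`. [cite: AtkinLehner1970, §2] -/
theorem cuspSymbol_mem_periodLatticeGamma1_of_atkinLehner_minus_of_nine_dvd (D : ModularParametrizationData W N) (h9 : 3 ^ 2 ∣ N)
    (Q : ℕ) [NeZero Q] (hQN : Q ∣ N) (hc : Nat.Coprime Q (N / Q)) (hQ : 1 < Q)
    (hε : atkinLehnerInvolution N 2 Q D.f = (-1 : ℂ) • D.f) (γ : Gamma0 N)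
    (hd : (Q : ℤ) ∣ ((γ : SL(2, ℤ)) 1 1 : ℤ) - 1) : cuspSymbol D.f γ ∈ periodLatticeGamma1 D.f :=
  mem_periodLatticeGamma1_of_two_mul_of_nine_dvd D h9 (cuspSymbol_mem_periodLattice D.f γ)
    (two_mul_cuspSymbol_mem_periodLatticeGamma1_of_atkinLehner_minus D.f Q hQN hc hQ hε γ hd)

/-- **The newform of an `X₀(N)`-datum is a `w_Q`-eigenform with sign `±1`** (Atkin–Lehner; tree theorem
`IsNewform0.exists_atkinLehnerInvolution_eq_smul`). [cite: AtkinLehner1970, Thm. 3] [cite: Knapp1993, Thm. 9.27(b)] -/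
theorem atkinLehner_eq_smul_or (D : ModularParametrizationData W N) (Q : ℕ) [NeZero Q] (hQN : Q ∣ N) (hc : Nat.Coprime Q (N / Q)) :
    atkinLehnerInvolution N 2 Q D.f = (1 : ℂ) • D.f ∨ atkinLehnerInvolution N 2 Q D.f = (-1 : ℂ) • D.f := by
  obtain ⟨ε, hε, h⟩ := D.isNewformOf.1.exists_atkinLehnerInvolution_eq_smul hQN hc
  rcases hε with h1 | h1
  · left; rw [h, h1]
  · right; rw [h, h1]

end Nine


end Summit.BirchSwinnertonDyer.BirchSwinnertonDyer.Theorems.ManinLocalTwoThree.SigmaHabitat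

end
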